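import Mathlib
import HarnessLib
import Summits.ValiantsHypothesis.ValiantsHypothesis.Theses.MonotoneRestoration
import Literature.Computability.AlgebraicComplexity.ArithCircuit
import Literature.Computability.AlgebraicComplexity.ArithCircuitProofs
import Literature.Computability.AlgebraicComplexity.MonotoneStructure
import Literature.Computability.AlgebraicComplexity.PermanentIrreducible
import Literature.ModelTheory.FiniteModelTheory.CkEquiv
import Summits.ValiantsHypothesis.ValiantsHypothesis.Theorems.MonotoneRestorationMonotoneRestorationQPCosetCount
import Summits.ValiantsHypothesis.ValiantsHypothesis.Theorems.MonotoneRestorationMonotoneRestorationQPSymmetricLB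
import Summits.ValiantsHypothesis.ValiantsHypothesis.Theorems.MonotoneRestorationMonotoneRestorationQPSupportSymmetrisation
import Summits.ValiantsHypothesis.ValiantsHypothesis.Theorems.MonotoneRestorationMonotoneRestorationQPSparseRegime
import Summits.ValiantsHypothesis.ValiantsHypothesis.Theorems.MonotoneRestorationMonotoneRestorationQPBeta
import Literature.Computability.AlgebraicComplexity.SymmetricArithCircuit
import Literature.Computability.AlgebraicComplexity.DawarWilsenach2025Proofs
import Literature.GroupTheory.PermutationGroups.SmallIndexSubgroups
import Summits.ValiantsHypothesis.ValiantsHypothesis.Theorems.MonotoneRestorationQP.Negative.LoadBearing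
import Summits.ValiantsHypothesis.ValiantsHypothesis.Theorems.MonotoneRestorationMonotoneRestorationQPPermSupportCount

/-! TTRL-lite variant V18988 of stmt-ValiantsHypothesis-15886

Action law (`mul_smul`) for the diagonal renaming action of `Equiv.Perm (Fin n)` on
`MvPolynomial (Fin n × Fin n) K`: renaming along the diagonal of `σ * τ` is renaming along the
diagonal of `τ` followed by renaming along the diagonal of `σ`.  Immediate from
`MvPolynomial.rename_rename` (composition of renamings) and the definitional fact that
`(σ * τ) x = σ (τ x)` for permutations.
-/

-- `Summit.ValiantsHypothesis.ValiantsHypothesis.…` is the tree's mandated single-conjunct layout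
-- (Sub = Summit), so the duplicated namespace component is intended.
set_option linter.dupNamespace false

namespace Summit.ValiantsHypothesis.ValiantsHypothesis.Theorems

open Summit.ValiantsHypothesis.ValiantsHypothesis.Theses.MonotoneRestoration
open Literature.Computability.AlgebraicComplexity

/-- **Diagonal renaming is a (left) action: the `mul_smul` law** (TTRL-lite variant V18988 of
`stub_altFixing_orbit_dichotomy`, item stmt-ValiantsHypothesis-15886).  For permutations
`σ τ : Equiv.Perm (Fin n)` and `q : MvPolynomial (Fin n × Fin n) K`, renaming `q` along
`p ↦ ((σ * τ) p.1, (σ * τ) p.2)` equals renaming along `p ↦ (τ p.1, τ p.2)` and then along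
`p ↦ (σ p.1, σ p.2)`.  Proof: `MvPolynomial.rename_rename` composes the two renamings, and the
composite map is definitionally the diagonal of `σ * τ` since `(σ * τ) x = σ (τ x)`
(`Equiv.Perm.mul_apply`). -/
theorem stub_altFixing_orbit_dichotomy_var18988 :
    ∀ (n : ℕ) (K : Type) [CommSemiring K] (σ τ : Equiv.Perm (Fin n))
      (q : MvPolynomial (Fin n × Fin n) K),
      MvPolynomial.rename (fun p : Fin n × Fin n => ((σ * τ) p.1, (σ * τ) p.2)) q =
        MvPolynomial.rename (fun p : Fin n × Fin n => (σ p.1, σ p.2))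
          (MvPolynomial.rename (fun p : Fin n × Fin n => (τ p.1, τ p.2)) q) := by
  intro n K _ σ τ q
  rw [MvPolynomial.rename_rename]
  rfl

end Summit.ValiantsHypothesis.ValiantsHypothesis.Theorems
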